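import Literature.MathematicalPhysics.QuantumFieldTheory.Balaban1983to89.B8Prop6CubeMemberFlatScalarGamma
import Literature.MathematicalPhysics.QuantumFieldTheory.Balaban1983to89.B8Prop6DentedCubeMemberGamma
import Literature.MathematicalPhysics.QuantumFieldTheory.Balaban1983to89.B8Eq191FlatLettersDentedCubeMember
import Literature.MathematicalPhysics.QuantumFieldTheory.Balaban1983to89.B8SockHFPDentedCubeMember

/-!
# `Balaban1983to89.B8Prop6DentedCubeMemberFlatScalarGamma` — [Balaban1985RegularSpaces] PROPOSITION 6 (p. 99) ∕ [Balaban1985Variational] (152)–(153), EXISTENCE HALF, AT THE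
# DENTED CUBE MEMBER FROM THE THREE REAL INEQUALITY FAMILIES ON THE DENTED TOWERS AND THE (1.59) γ CLAUSE — EDITION γ, dented twin of Fγ5
# `B8Prop6CubeMemberFlatScalarGamma` ((d3) MAP item (3))

statement-level skeleton of published theorems with citation tags; proofs where landed; nothing here is a claim about the
Yang–Mills mass gap

`[Balaban1985RegularSpaces]` ("B8" = [6], CMP **99** (1985) 75–102): Prop. 6 p. 99, Thm 4 p. 88, Prop. 5 (1.106)–(1.109) pp. 93–94, (1.58)–(1.62) pp. 86–87, (1.91)–(1.92) p. 91, (1.98)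
p. 92, (1.101) p. 93, (1.31) p. 82, (1.131) p. 99; `[Balaban1985Variational]` ("[15]", CMP **102** (1985) 277–309) (148)–(153) p. 301; [4] = `[Balaban1985BackgroundPropagators]`
Thms 3.1–3.3 pp. 397–399; [B6] = `[Balaban1984PropagatorsII]` (2.3) p. 224, Prop. 2.6 p. 247.  PDF held: `paper:balaban1985-cmp99-regular-spaces-gauge-fixing`,
`paper:balaban1985-cmp102-variational-background` (pp. 24–25).

CITATION HEADER (lean-in-tree rule).  Cell `pub-ymgap` (HUMAN RULING D-0062, Track A), DAG node N05 = [B8], seat `pub-ymgap-dag-n05-e` (g31; R141 (C) row s3b, the (β) road — dented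
twins of the flat line, dag-n05-c standing GO I.42366).  WHY THIS FILE.  Fγ5 `B8Prop6CubeMemberFlatScalarGamma` (this seat g10) reduces [6] Proposition 6's existence half at
a PURE cube to (i) three REAL inequality families on the explicit flat Dirichlet matrices `T⁻¹`, `T⁻¹(T⁻¹Qᵀ)(QT⁻¹T⁻¹Qᵀ)⁻¹`, `1 − T⁻¹Qᵀ(QT⁻¹T⁻¹Qᵀ)⁻¹QT⁻¹` at every truncation ([4]
Thms 3.1–3.2 at `U = 1`) and (ii) the (1.59) clause in the γ currency, by composing the generic Prop.-5 servers (`B8SockHFPRD.sockHFP₀_body_of_join_RD`,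
`B8SockHFP59Gamma.sockHFP_body_of_join_59_γ`), the generic flat letters (`B8Eq191FlatLettersRDOfReal.flatLettersRD_of_real`) and the γ driver's Prop.-6 (Fγ4) — the ONLY
member-specific inputs being the cube member's cell geometry.  THIS FILE is the same composition at the DENTED member `{Ω′_j}` of [15] (148)–(150) (NODE 00's `CubeB8D`,
p655171): every member lemma the pure proof names is replaced by its dented twin (`hΩ_sq`, `lamBPT_hbox_pred ∕ lamBPT_hclass ∕ bdryLayer_dented` — `B8DentedCubeMemberLamBPrime`;
`htw_lamST ∕ h8lt_lamST ∕ h8top_lamST` — `B8SockHFPDentedCubeMember`; `sq_zero_finite ∕ lamST_finite ∕ sq_subset_zero ∕ tower_meets_dented ∕ towers_disjoint_dented` —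
`B8Eq191FlatLettersDentedCubeMember`; `prop6_exists_dentedMember_at_γ₃ ∕ thm4_hypotheses_one_cutFixed_dented_γ` — `B8Prop6DentedCubeMemberGamma`); the numeric window
bookkeeping is byte-identical.

WHAT THIS MODULE PROVES (kernel, 0 sorry; `c : Node00.CubeB8D d L K Ω`; `𝔸` a non-trivial C⋆-algebra).
* ★★ `prop6_dentedMember_flat_of_real_γ` — Fγ5's `prop6_cubeMember_flat_of_real_γ` with `cubeFam false ↦ c.sq`, `cubeLamS … n ↦ c.lamST n` (`c.lamS` at the top),
  `cubeLamBP' ↦ c.lamBPT`; hypotheses: the weights `w ≥ 0`, the three REAL families AT EVERY TRUNCATION `1 ≤ n ≤ k` of the dented member (for `n < k` these are the pure member's —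
  `lamST_of_lt` — served by dag-n05-c's proved 𝒢-bound chain; at `n = k` they are the named `GBoundDentedCubeMemberPrinted` road), and `H59D₁` (Theorem 4's two-member (1.59) clause
  with the exterior-collar allowance, γ index) at the dented member; conclusion = `prop6_exists_dentedMember_at_γ₃`'s (the first seven conjuncts of `GaugedBoundB8D` in raw letters).
* ★★ `prop6_dentedMember_flat_of_scalar_γ` — the same with `H59D₁` replaced by the SCALAR flat two-line clause at every truncation over `c.lamBPT m` (`flat159_clause_of_scalar_bdryβ`,
  class-parametric): NO gauge-field hypothesis remains.
HONEST SCOPE ∕ A6.  Conditional on the displayed REAL families and scalar clauses at the dented member (their servers: pure for `n < k`; at `n = k` the two dented named facts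
`GBoundDentedCubeMemberPrinted` ∕ `Ineq159FlatDentedCubeMemberPrinted` through the dented twins of dag-n05-c's REAL-from-𝒢-bound chain and of Fγ10a — NOT in this file);
nothing of [4]∕[6]∕[15] asserted; `≤` for print's `<`; `ℤᵈ` carriers.  Count-neutral; N05 ∕ N07 NOT discharged; one finite `𝕋⁴` programme at fixed `ε`, Bałaban as printed; nothing
continuum ∕ ℝ⁴ ∕ OS ∕ mass-gap ∕ Clay.  No `sorry`, no `def`, no `instance`, no `notation`.  Unit `pub-ymgap-dag-n05-e` (g31), 2026-08-28.
-/

noncomputable section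

open NormedSpace

namespace Literature.MathematicalPhysics.QuantumFieldTheory.Balaban1983to89.B8Prop6DentedCubeMemberFlatScalarGamma


open scoped Matrix
open B7Prop1Explicit B7Prop2Explicit B7Prop1Local B7Eq92Concrete B8Ineq130
open B7Prop2Explicit (C0 c2')
open B7Prop3Flat (c3)
open B7Prop10General (C6)
open B7Eq78Linearization (QprimeIter zdBlocking)
open B8Ineq132 (covDerivFwd InAk BondTouches)
open B8Ineq133 (cutFixed)
open B8Eq115GaugeFixing (localGauge)
open B8Eq119TwistedAxial (InAx Restr129 bgT)
open B8Eq184Proof (gaugeExp cfgExp)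
open B8Lemma1NonAbelian (mulCfg)
open B8Eq140Level (SideTouches)
open B8Eq146AExpansion (iEta)
open B7Prop4GeneralLevels (linCovIter)
open B8Eq155JBound (Jcur wsup)
open B8ScaledSupNorm (bondNorm msup)
open B8Thm2LogB (blockTop)
open B8Eq138LandauZd (IsLandau138W logCfg covLap QT)
open B8Eq1117Concrete (XSpace)
open B8Prop5ContractionKLevel (Bd2)
open B8LambdaSpaceKLevel (wt)
open B8Eq131Cubes (tcube tLo tHi ctr)
open B8Eq131CubesAdmissible (cubeFam)
open B8CubeMemberZd (cubeLamS)
open B8Prop6DentedCubeMemberGamma (thm4_hypotheses_one_cutFixed_dented_γ prop6_exists_dentedMember_at_γ₃)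
open B8DentedCubeMemberLamBPrime (lamBPT_hbox_pred lamBPT_hclass bdryLayer_dented)
open B8Thm4ExistsConcreteGamma (thm4_windows_γ)
open B9SupplySockB9P3ZdBeta (CrossB)
open B8SockHFPWindows (hfpWindows_of_guard)
open B7ConclGaugeLin (two_le_C6')
open B8SockHFPRD (sockHFP₀_body_of_join_RD)
open B8SockHFP59Gamma (sockHFP_body_of_join_59_γ)
open B8SockHFPDentedCubeMember (htw_lamST h8lt_lamST h8top_lamST)
open B8Prop5KLevelLetters (hP5base_of_HFP hP5_of_HFP)
open Literature.MathematicalPhysics.QuantumLattice (blockMap)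
open B8Eq191FlatLettersDirichlet (exists_towerFinset)
open B8Eq191FlatLettersDentedCubeMember (lamST_finite sq_zero_finite sq_subset_zero tower_meets_dented towers_disjoint_dented)
open B8DentedCubeMemberZd (hΩ_sq lamST_top)
open Node00 (CubeB8D)
open B8Eq191FlatLettersRDOfReal (flatLettersRD_of_real)
open B8Ineq159FlatOfScalarBdryBeta (flat159_clause_of_scalar_bdryβ)
open B8Eq138LandauZd (IsLandau138)

export B7Prop1Explicit (Site)

variable {d : ℕ}

variable {𝔸 : Type} [CStarAlgebra 𝔸] [Nontrivial 𝔸]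

/-! ## Proposition 6 at the cube member from three real inequality families and the REPAIRED (1.59) clause for `G(1)` -/

open Classical in
/-- ★★ **PROPOSITION 6 (p. 99), EXISTENCE HALF, AT THE DENTED CUBE MEMBER (`CubeB8D`, [15] (148)–(150)) FROM THREE REAL INEQUALITY FAMILIES AND THEOREM 4's (1.59) CLAUSE
`H59Dβ₁` AT BACKGROUND `1`, EDITION γ** — g8's `prop6_cubeMember_flat_of_real_bdryβ` (p553065) with the (1.59) clause's averaging index over the split print
class `cubeLamBP' … m j ∪ {level-0 crossing bonds of □₀}`; the three REAL families VERBATIM ((1.101) for `T⁻¹`, (1.92)+`Δ`-entry for `T⁻¹(T⁻¹Qᵀ)(QT⁻¹T⁻¹Qᵀ)⁻¹`,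
(1.98) for `1 − T⁻¹Qᵀ(QT⁻¹T⁻¹Qᵀ)⁻¹QT⁻¹`, real lattice functions, Dirichlet on `□₀`); Proposition 5's base from the REAL letters (`sockHFP₀_body_of_join_RD`,
unchanged), its step from `B8SockHFP59Gamma.sockHFP_body_of_join_59_γ` with the five γ windows derived here from `thm4_windows_γ`; assembled by
`B8Prop6CubeMemberFlat3Gamma.prop6_exists_cubeMember_at_γ₃`.  Threshold `min (min c₀ c_P) c₃`.
[cite: Balaban1985RegularSpaces, Prop. 6 p.99, Thm 4 p.88, Prop. 5 (1.106)–(1.109) p.94, Prop. 3 p.87, (1.92) p.91, (1.98) p.92, (1.101) p.93, (1.59) p.86, (1.31) p.82; Balaban1985BackgroundPropagators, Thms 3.1–3.3 pp.397–399] -/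
theorem prop6_dentedMember_flat_of_real_γ (hd2 : 2 ≤ d) {L : ℕ} (hL : 2 ≤ L) {B₀ B₀' B₀'H B₂' BG BR : ℝ} (hB₀ : 0 < B₀) (hB₀' : 0 < B₀')
    (hB : 2 ≤ 5 * (d : ℝ) * L * B₀) (hB₀'H : 0 < B₀'H) (hB₂' : 0 ≤ B₂') (hBG : 0 ≤ BG) (hBR : 0 ≤ BR)
    (hfree : 3 * (2 * (d : ℝ) * (L : ℝ) ^ 2) * BG * BR ≤ B₀') {Bbd : ℝ} (hBbd : 0 ≤ Bbd) (hBd : 4 * Bbd ≤ ((d : ℝ) * L - 1) * B₀) :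
    ∃ c₁ : ℝ, 0 < c₁ ∧ ∀ (η : ℝ), 0 < η → ∀ {K : ℕ} {Ω : ℕ → Set (Site d)} (c : CubeB8D d L K Ω),
      ∀ (U₀ : Site d → Fin d → 𝔸ˣ), (∀ x κ, U₀ x κ ∈ unitaryUnits 𝔸) → ∀ (α₀ : ℝ), 0 < α₀ →
      C0 d * (α₀ * (L : ℝ) ^ 2) ≤ 1 / 3 → 2 * (α₀ * (L : ℝ) ^ 2) ≤ c2' d L →
      InAk L c.k η α₀ Ω U₀ →
      11 * (d : ℝ) ^ 2 * (L : ℝ) ^ 2 * α₀ + ((c.M : ℝ) + 4 * c.ρ) * d * (L : ℝ) ^ 2 * α₀ ≤ 1 / 6 →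
      (L : ℝ) ^ 3 * α₀ + 6 * d * (L : ℝ) ^ 2 * c.M * α₀ ≤ c₁ →
      -- the weights of `Q′ᵀaQ′` (free, nonnegative) and THE THREE REAL INEQUALITY FAMILIES at every truncation `n ≤ k` on the explicit matrices
      ∀ (w : ℕ → ℝ), (∀ j, 0 ≤ w j) →
      (∀ n, 1 ≤ n → n ≤ c.k → ∀ (S : Finset (Site d)), (∀ x, x ∈ S ↔ x ∈ c.sq 0) →
        ∀ (B : Finset (ℕ × Site d)), (∀ p, p ∈ B ↔ p.1 ≤ n ∧ p.2 ∈ c.lamST n p.1) →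
        ∀ (K : Site d → Site d → ℝ), (∀ x z, K x z =
          ((η ^ 2)⁻¹ * ∑ μ : Fin d, ((2 : ℝ) * (if z = x then (1 : ℝ) else 0) - (if z = x + e μ then (1 : ℝ) else 0)
            - (if z = x - e μ then (1 : ℝ) else 0))) +
          (∑ j ∈ Finset.range (n + 1), (if blockMap (L ^ j) x ∈ c.lamST n j ∧ blockMap (L ^ j) z = blockMap (L ^ j) x then
            w j * ((((L : ℝ) ^ d)⁻¹) ^ j) ^ 2 else 0))) →
        ∀ (T : Matrix ↥S ↥S ℝ), T = Matrix.of (fun x z : ↥S => K x.1 z.1) →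
        ∀ (Q : Matrix ↥B ↥S ℝ), Q = Matrix.of (fun (p : ↥B) (z : ↥S) =>
          if blockMap (L ^ p.1.1) z.1 = p.1.2 then (((L : ℝ) ^ d)⁻¹) ^ p.1.1 else 0) →
        -- (1.101) for `T⁻¹`, real lattice functions
        (∀ (ρ' : ↥S → ℝ) (r : ℝ), 0 ≤ r →
          (∀ j, j ≤ n → ∀ z : ↥S, z.1 ∈ c.sq j → wt L η j ^ 2 * |ρ' z| ≤ r) →
          ∀ φ : Site d → ℝ, (∀ x, x ∉ c.sq 0 → φ x = 0) → (∀ v : ↥S, φ v.1 = ∑ z : ↥S, T⁻¹ v z * ρ' z) →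
          (∀ x, |φ x| ≤ BG * r) ∧
          ∀ j, j ≤ n → ∀ p ∈ {b : Site d × Fin d | SideTouches (c.sq j) b.1 b.2},
            wt L η j * |η⁻¹ * (φ (p.1 + e p.2) - φ p.1)| ≤ BG * r) ∧
        -- (1.92) and the p. 93 `Δ`-entry for `T⁻¹(T⁻¹Qᵀ)(QT⁻¹T⁻¹Qᵀ)⁻¹`, real `X`
        (∀ (X : ↥B → ℝ) (s : ℝ), 0 ≤ s → (∀ p', |X p'| ≤ s) →
          ∀ φ : Site d → ℝ, (∀ x, x ∉ c.sq 0 → φ x = 0) →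
          (∀ v : ↥S, φ v.1 = ∑ p' : ↥B, (T⁻¹ * (T⁻¹ * Qᵀ) * (Q * T⁻¹ * T⁻¹ * Qᵀ)⁻¹) v p' * X p') →
          (∀ x, |φ x| ≤ B₀'H * s) ∧
          (∀ j, j ≤ n → ∀ p ∈ {b : Site d × Fin d | SideTouches (c.sq j) b.1 b.2},
            wt L η j * |η⁻¹ * (φ (p.1 + e p.2) - φ p.1)| ≤ B₀'H * s) ∧
          (∀ j, j ≤ n → ∀ x ∈ c.sq j,
            wt L η j ^ 2 * |∑ μ : Fin d, (η ^ 2)⁻¹ * (2 * φ x - φ (x + e μ) - φ (x - e μ))| ≤ B₂' * s)) ∧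
        -- (1.98) for `1 − T⁻¹Qᵀ(QT⁻¹T⁻¹Qᵀ)⁻¹QT⁻¹`, real lattice functions
        (∀ (ρ' : ↥S → ℝ) (r : ℝ), 0 ≤ r →
          (∀ j, j ≤ n → ∀ z : ↥S, z.1 ∈ c.sq j → wt L η j ^ 2 * |ρ' z| ≤ r) →
          ∀ j, j ≤ n → ∀ v : ↥S, v.1 ∈ c.sq j →
            wt L η j ^ 2 * |ρ' v - ∑ z : ↥S, (T⁻¹ * (Qᵀ * ((Q * T⁻¹ * T⁻¹ * Qᵀ)⁻¹ * (Q * T⁻¹)))) v z * ρ' z| ≤ BR * r)) →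
      -- (1.59) for `G(1)` IN THE REPAIRED CURRENCY — Theorem 4's two-member clause at background `1` with the support clause and the
      -- exterior-collar allowance (VERBATIM `B8Prop6CubeMemberFlat3Bdry`'s `H59D₁`)
      ((∀ m, 1 ≤ m → m ≤ c.k → ∀ (u : Site d → 𝔸ˣ) (W : Site d → Fin d → 𝔸ˣ) (A' : Site d → Fin d → 𝔸),
        (∀ x, u x ∈ unitaryUnits 𝔸) → (∀ x, x ∉ c.sq 0 → u x = 1) →
          mgauge (1 : Site d → Fin d → 𝔸ˣ) u W = (cutFixed L (tLo c.a c.ρ) (tHi c.a c.M c.ρ) U₀ c.k (ctr c.a c.M)) →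
          Restr129 L m (c.lamST m) (1 : Site d → Fin d → 𝔸ˣ) u →
          IsLandau138W L m η (c.sq 0) (c.lamST m) (1 : Site d → Fin d → 𝔸ˣ) W →
        (∀ y τ, IsSelfAdjoint (A' y τ)) →
        (∀ j, j ≤ m → ∀ y τ, SideTouches (c.sq j) y τ →
        W y τ = cfgExp η A' y τ ∧
          ‖A' y τ‖ ≤ (2 * (L * (5 * (d : ℝ) * L * B₀ * (((L : ℝ) ^ 3 * α₀) + (6 * d * (L : ℝ) ^ 2 * c.M * α₀)))) + 8 * (8 * B₀' * (5 * (d : ℝ) * L * B₀) * (((L : ℝ) ^ 3 * α₀) + (6 * d * (L : ℝ) ^ 2 * c.M * α₀)))) * ((L : ℝ) ^ j * η)⁻¹) →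
        (∀ y τ, (∀ j, j ≤ m → ¬ SideTouches (c.sq j) y τ) → A' y τ = 0) →
        msup L m η (-(1 : ℝ)) (fun j (b : Site d × Fin d) => SideTouches (c.sq j) b.1 b.2) (fun b => A' b.1 b.2)
        ≤ B₀ * (bondNorm L m η (-(3 : ℝ)) c.sq (fun x μ => Jcur η (1 : Site d → Fin d → 𝔸ˣ) A' μ x)
        + wsup 1 (fun p : {p : ℕ × (Site d × Fin d) // p.1 ≤ m ∧ (p.2 ∈ c.lamBPT m p.1 ∨ (p.1 = 0 ∧ CrossB (c.sq 0) p.2))} =>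
        linCovIter L (1 : Site d → Fin d → 𝔸ˣ) (iEta η A') p.1.1 p.1.2.1 p.1.2.2))
        + Bbd * msup L m η (-(1 : ℝ)) (fun j (b : Site d × Fin d) => j = 0 ∧ SideTouches (c.sq 0) b.1 b.2 ∧
            ¬ BondTouches (c.sq 0) b.1 b.2) (fun b => A' b.1 b.2) ∧
        msup L m η (-(2 : ℝ)) (fun j (t : Fin d × Fin d × Site d) => SideTouches (c.sq j) t.2.2 t.2.1)
        (fun t => covDerivFwd η (1 : Site d → Fin d → 𝔸ˣ) t.1 (fun z => A' z t.2.1) t.2.2)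
        ≤ B₀ * (bondNorm L m η (-(3 : ℝ)) c.sq (fun x μ => Jcur η (1 : Site d → Fin d → 𝔸ˣ) A' μ x)
        + wsup 1 (fun p : {p : ℕ × (Site d × Fin d) // p.1 ≤ m ∧ (p.2 ∈ c.lamBPT m p.1 ∨ (p.1 = 0 ∧ CrossB (c.sq 0) p.2))} =>
        linCovIter L (1 : Site d → Fin d → 𝔸ˣ) (iEta η A') p.1.1 p.1.2.1 p.1.2.2))
        + Bbd * msup L m η (-(1 : ℝ)) (fun j (b : Site d × Fin d) => j = 0 ∧ SideTouches (c.sq 0) b.1 b.2 ∧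
            ¬ BondTouches (c.sq 0) b.1 b.2) (fun b => A' b.1 b.2))) →
      ∃ u : Site d → 𝔸ˣ, (∀ x, u x ∈ unitaryUnits 𝔸) ∧ (∀ x, x ∉ c.sq 0 → u x = 1) ∧
        Restr129 L c.k c.lamS (1 : Site d → Fin d → 𝔸ˣ) u ∧
        IsLandau138W L c.k η (c.sq 0) c.lamS (1 : Site d → Fin d → 𝔸ˣ)
          (gaugeAct u⁻¹ (cutFixed L (tLo c.a c.ρ) (tHi c.a c.M c.ρ) U₀ c.k (ctr c.a c.M))) ∧
        (∀ j, j ≤ c.k → ∀ b ∈ {b : Site d × Fin d | SideTouches (c.sq j) b.1 b.2},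
          gaugeAct u⁻¹ (cutFixed L (tLo c.a c.ρ) (tHi c.a c.M c.ρ) U₀ c.k (ctr c.a c.M)) b.1 b.2 =
              cfgExp η (logCfg η (gaugeAct u⁻¹ (cutFixed L (tLo c.a c.ρ) (tHi c.a c.M c.ρ) U₀ c.k (ctr c.a c.M)))) b.1 b.2 ∧
            IsSelfAdjoint (logCfg η (gaugeAct u⁻¹ (cutFixed L (tLo c.a c.ρ) (tHi c.a c.M c.ρ) U₀ c.k (ctr c.a c.M))) b.1 b.2) ∧
            ‖logCfg η (gaugeAct u⁻¹ (cutFixed L (tLo c.a c.ρ) (tHi c.a c.M c.ρ) U₀ c.k (ctr c.a c.M))) b.1 b.2‖ ≤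
              (5 * (d : ℝ) * L * B₀ * ((L : ℝ) ^ 3 * α₀ + 6 * d * (L : ℝ) ^ 2 * c.M * α₀)) * ((L : ℝ) ^ j * η)⁻¹) ∧
        (∀ x, ((localGauge L (tLo c.a c.ρ) (tHi c.a c.M c.ρ) U₀ c.k (ctr c.a c.M))⁻¹ * u) x ∈ unitaryUnits 𝔸) ∧
        AgreeOn (tlo L (tLo c.a c.ρ) c.k) (thi L (tHi c.a c.M c.ρ) c.k)
          (gaugeAct ((localGauge L (tLo c.a c.ρ) (tHi c.a c.M c.ρ) U₀ c.k (ctr c.a c.M))⁻¹ * u)⁻¹ U₀)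
          (gaugeAct u⁻¹ (cutFixed L (tLo c.a c.ρ) (tHi c.a c.M c.ρ) U₀ c.k (ctr c.a c.M))) := by
  have hL1 : 1 ≤ L := le_trans (by norm_num) hL
  have hd1 : 1 ≤ d := le_trans (by norm_num) hd2
  have hd0 : 0 < d := hd1
  have hLr : (1 : ℝ) ≤ L := by exact_mod_cast hL1
  have hdr : (1 : ℝ) ≤ d := by exact_mod_cast hd1
  have hC6 : (2 : ℝ) ≤ C6 d := two_le_C6'
  obtain ⟨c₀, hc₀, P6⟩ := prop6_exists_dentedMember_at_γ₃ (𝔸 := 𝔸) hd2 hL hB₀ hB₀' hB hBbd hBd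
  obtain ⟨cP, hcP, WIN⟩ := hfpWindows_of_guard hd1 hL1 hB₀ hB₀' hB hB₀'H hB₂' hBG hBR one_pos hfree
  obtain ⟨c₃, hc₃γ0, WINγ⟩ := thm4_windows_γ hd1 hL1 hB₀ hB₀' hB
  refine ⟨min (min c₀ cP) c₃, lt_min (lt_min hc₀ hcP) hc₃γ0, ?_⟩
  intro η hη K Ω c U₀ hU₀ α₀ hα hα3 hα2 hA hsmall hc w hw REAL H59
  have hk : 1 ≤ c.k := c.one_le_k
  have hρL : L ≤ c.ρ := c.L_le_ρ
  have hρM : c.ρ ≤ c.M := c.ρ_le_M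
  have hc0 : (L : ℝ) ^ 3 * α₀ + 6 * d * (L : ℝ) ^ 2 * c.M * α₀ ≤ c₀ := hc.trans ((min_le_left _ _).trans (min_le_left _ _))
  have hcP' : (L : ℝ) ^ 3 * α₀ + 6 * d * (L : ℝ) ^ 2 * c.M * α₀ ≤ cP := hc.trans ((min_le_left _ _).trans (min_le_right _ _))
  have hc3' : (L : ℝ) ^ 3 * α₀ + 6 * d * (L : ℝ) ^ 2 * c.M * α₀ ≤ c₃ := hc.trans (min_le_right _ _)
  have hρ : 1 ≤ c.ρ := hL1.trans hρL
  have hM1 : 1 ≤ c.M := hρ.trans hρM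
  have hLpos : (0 : ℝ) < L := by positivity
  have hMpos : (0 : ℝ) < c.M := by exact_mod_cast hM1
  have hdpos : (0 : ℝ) < d := by exact_mod_cast hd0
  have hα₀' : 0 < (L : ℝ) ^ 3 * α₀ := by positivity
  have hα₁' : 0 < 6 * (d : ℝ) * (L : ℝ) ^ 2 * c.M * α₀ := by positivity
  -- the pair `(1, U₀″)` at the member
  obtain ⟨hmem, h33, h34, hAx, h135, h66⟩ :=
    thm4_hypotheses_one_cutFixed_dented_γ hL hd1 c U₀ hU₀ hα hα3 hα2 hη hA hsmall
  have hone : ∀ x κ, (1 : Site d → Fin d → 𝔸ˣ) x κ ∈ unitaryUnits 𝔸 := fun _ _ => (unitaryUnits 𝔸).one_mem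
  -- the windows at `(α₀, α₁) := (L³α₀, 6dL²Mα₀)`
  obtain ⟨hside, -, -, hsmall₁, -, -, hα3', hα4', hsmallW, hc₃, hsc, hα₃', hs₁, hs₂, hs₃, hs₄, hs₅, hs₆, hs₇, hsm, hprod8, hcA',
    ha₁', hb₁', hθ, h103, h106⟩ := WIN _ _ hα₀' hα₁' hcP' _ _ _ _ _ _ _ _ rfl rfl rfl rfl rfl rfl rfl rfl
  -- EDITION γ: [3] Prop. 4's windows one level lower and the (1.61) window with `C₂ := 16·131072(d+1)²·L²`, read at `α₂ := c⋆ ≤ 2(L c⋆) + 8α₄`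
  obtain ⟨g5, g6, g7, g9, g10, g13, g14⟩ := WINγ _ _ hα₀' hα₁' hc3' _ _ rfl rfl
  -- smallness read by the plain-currency bridges: `α₄ ≤ 1/84`, `c⋆ ≤ 1/12`, `a ≤ 1/4`, `2a ≤ c⋆`
  have hsum0 : 0 ≤ (L : ℝ) ^ 3 * α₀ + 6 * d * (L : ℝ) ^ 2 * c.M * α₀ := by positivity
  have hcs0 : 0 ≤ 5 * (d : ℝ) * L * B₀ * ((L : ℝ) ^ 3 * α₀ + 6 * d * (L : ℝ) ^ 2 * c.M * α₀) := by positivity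
  have hα₄0 : 0 ≤ 8 * B₀' * (5 * (d : ℝ) * L * B₀) * ((L : ℝ) ^ 3 * α₀ + 6 * d * (L : ℝ) ^ 2 * c.M * α₀) := by positivity
  have hs84 : 8 * B₀' * (5 * (d : ℝ) * L * B₀) * ((L : ℝ) ^ 3 * α₀ + 6 * d * (L : ℝ) ^ 2 * c.M * α₀) ≤ 1 / 84 := by
    have h := mul_le_mul_of_nonneg_right hC6 (mul_nonneg (by norm_num : (0 : ℝ) ≤ 2) hα₄0)
    nlinarith only [hs₁, h, hα₄0]
  have hcs12 : 5 * (d : ℝ) * L * B₀ * ((L : ℝ) ^ 3 * α₀ + 6 * d * (L : ℝ) ^ 2 * c.M * α₀) ≤ 1 / 12 := by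
    have h1 : 5 * (d : ℝ) * L * B₀ * ((L : ℝ) ^ 3 * α₀ + 6 * d * (L : ℝ) ^ 2 * c.M * α₀) ≤
        L * (5 * (d : ℝ) * L * B₀ * ((L : ℝ) ^ 3 * α₀ + 6 * d * (L : ℝ) ^ 2 * c.M * α₀)) := le_mul_of_one_le_left hcs0 hLr
    have h2 : L * (5 * (d : ℝ) * L * B₀ * ((L : ℝ) ^ 3 * α₀ + 6 * d * (L : ℝ) ^ 2 * c.M * α₀)) ≤
        d * (L * (5 * (d : ℝ) * L * B₀ * ((L : ℝ) ^ 3 * α₀ + 6 * d * (L : ℝ) ^ 2 * c.M * α₀))) :=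
      le_mul_of_one_le_left (mul_nonneg hLpos.le hcs0) hdr
    linarith only [h1, h2, hsc]
  have ha : 6 * (d : ℝ) * (L : ℝ) ^ 2 * c.M * α₀ ≤ 1 / 4 := by
    have h1 : 6 * (d : ℝ) * (L : ℝ) ^ 2 * c.M * α₀ ≤ (d : ℝ) * L * (6 * (d : ℝ) * (L : ℝ) ^ 2 * c.M * α₀) := by
      have hdL : (1 : ℝ) ≤ (d : ℝ) * L := one_le_mul_of_one_le_of_one_le hdr hLr
      exact le_mul_of_one_le_left hα₁'.le hdL
    linarith only [h1, hsmall₁]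
  have ha2 : 2 * (6 * (d : ℝ) * (L : ℝ) ^ 2 * c.M * α₀) ≤ 5 * (d : ℝ) * L * B₀ * ((L : ℝ) ^ 3 * α₀ + 6 * d * (L : ℝ) ^ 2 * c.M * α₀) := by
    have h1 : 2 * (6 * (d : ℝ) * (L : ℝ) ^ 2 * c.M * α₀) ≤ 2 * ((L : ℝ) ^ 3 * α₀ + 6 * d * (L : ℝ) ^ 2 * c.M * α₀) := by linarith only [hα₀']
    exact h1.trans (mul_le_mul_of_nonneg_right hB hsum0)
  -- the γ windows at `α₂ := c⋆` (monotone in `c⋆ ≤ 2(L c⋆) + 8α₄`)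
  have hcsw : 5 * (d : ℝ) * L * B₀ * ((L : ℝ) ^ 3 * α₀ + 6 * d * (L : ℝ) ^ 2 * c.M * α₀) ≤
      2 * (L * (5 * (d : ℝ) * L * B₀ * ((L : ℝ) ^ 3 * α₀ + 6 * d * (L : ℝ) ^ 2 * c.M * α₀)))
        + 8 * (8 * B₀' * (5 * (d : ℝ) * L * B₀) * ((L : ℝ) ^ 3 * α₀ + 6 * d * (L : ℝ) ^ 2 * c.M * α₀)) := by
    have h1 : 5 * (d : ℝ) * L * B₀ * ((L : ℝ) ^ 3 * α₀ + 6 * d * (L : ℝ) ^ 2 * c.M * α₀) ≤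
        L * (5 * (d : ℝ) * L * B₀ * ((L : ℝ) ^ 3 * α₀ + 6 * d * (L : ℝ) ^ 2 * c.M * α₀)) := le_mul_of_one_le_left hcs0 hLr
    linarith only [h1, hcs0, hα₄0]
  have hLcsw := mul_le_mul_of_nonneg_left hcsw hLpos.le
  have h16γ : 16 * ((L : ℝ) * (5 * (d : ℝ) * L * B₀ * ((L : ℝ) ^ 3 * α₀ + 6 * d * (L : ℝ) ^ 2 * c.M * α₀))) ≤ 1 := by
    linarith only [g7, hLcsw]
  have hsmallγ : Real.exp (4 * (800 * ((d : ℝ) + 1) ^ 2 * ((d : ℝ) + 4)) * ((L : ℝ) ^ 2 * ((L : ℝ) ^ 3 * α₀)))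
      * (1 + 8 * (131072 * ((d : ℝ) + 1) ^ 2) * ((L : ℝ) * (5 * (d : ℝ) * L * B₀ * ((L : ℝ) ^ 3 * α₀ + 6 * d * (L : ℝ) ^ 2 * c.M * α₀)))) ≤ 2 := by
    refine le_trans (mul_le_mul_of_nonneg_left ?_ (Real.exp_pos _).le) g9
    have h := mul_le_mul_of_nonneg_left hLcsw (show (0 : ℝ) ≤ 8 * (131072 * ((d : ℝ) + 1) ^ 2) by positivity)
    linarith only [h]
  have hc₃γ : 2 * ((L : ℝ) * (5 * (d : ℝ) * L * B₀ * ((L : ℝ) ^ 3 * α₀ + 6 * d * (L : ℝ) ^ 2 * c.M * α₀))) ≤ c3 d L := by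
    linarith only [g10, hLcsw]
  have h61γ : 2 * (5 * (d : ℝ) * L * B₀ * ((L : ℝ) ^ 3 * α₀ + 6 * d * (L : ℝ) ^ 2 * c.M * α₀)) ^ 2
      + 20 * d * ((L : ℝ) ^ 3 * α₀) * (5 * (d : ℝ) * L * B₀ * ((L : ℝ) ^ 3 * α₀ + 6 * d * (L : ℝ) ^ 2 * c.M * α₀))
      + 2 * (16 * (131072 * ((d : ℝ) + 1) ^ 2) * (L : ℝ) ^ 2) * (5 * (d : ℝ) * L * B₀ * ((L : ℝ) ^ 3 * α₀ + 6 * d * (L : ℝ) ^ 2 * c.M * α₀)) ^ 2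
      ≤ (L : ℝ) ^ 3 * α₀ + 6 * d * (L : ℝ) ^ 2 * c.M * α₀ := by
    have hsq : (5 * (d : ℝ) * L * B₀ * ((L : ℝ) ^ 3 * α₀ + 6 * d * (L : ℝ) ^ 2 * c.M * α₀)) ^ 2 ≤
        (2 * (L * (5 * (d : ℝ) * L * B₀ * ((L : ℝ) ^ 3 * α₀ + 6 * d * (L : ℝ) ^ 2 * c.M * α₀)))
          + 8 * (8 * B₀' * (5 * (d : ℝ) * L * B₀) * ((L : ℝ) ^ 3 * α₀ + 6 * d * (L : ℝ) ^ 2 * c.M * α₀))) ^ 2 :=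
      pow_le_pow_left₀ hcs0 hcsw 2
    have hlin : 20 * d * ((L : ℝ) ^ 3 * α₀) * (5 * (d : ℝ) * L * B₀ * ((L : ℝ) ^ 3 * α₀ + 6 * d * (L : ℝ) ^ 2 * c.M * α₀)) ≤
        20 * d * ((L : ℝ) ^ 3 * α₀) * (2 * (L * (5 * (d : ℝ) * L * B₀ * ((L : ℝ) ^ 3 * α₀ + 6 * d * (L : ℝ) ^ 2 * c.M * α₀)))
          + 8 * (8 * B₀' * (5 * (d : ℝ) * L * B₀) * ((L : ℝ) ^ 3 * α₀ + 6 * d * (L : ℝ) ^ 2 * c.M * α₀))) :=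
      mul_le_mul_of_nonneg_left hcsw (by positivity)
    have hK0 : (0 : ℝ) ≤ 2 * (16 * (131072 * ((d : ℝ) + 1) ^ 2) * (L : ℝ) ^ 2) := by positivity
    have hsq' := mul_le_mul_of_nonneg_left hsq hK0
    linarith only [g14, hsq, hlin, hsq']
  -- the member's geometry (edition γ: the split print class `cubeLamBP'`, box law «box ⊂ □_{j−1}», inner ∕ crossing ∕ mirrored trichotomy)
  have hΩc := hΩ_sq c
  have hboxc := lamBPT_hbox_pred c hL1
  have hclassc := lamBPT_hclass c hL1
  have htw := htw_lamST c hL1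
  have h8lt := h8lt_lamST c
  have h8top := h8top_lamST c hL1
  refine P6 η hη c U₀ hU₀ α₀ hα hα3 hα2 hA hsmall hc0 ?_ ?_ H59
  · -- `P5base₁`: the base body at `U₀ = 1` + the plain-currency bridge
    refine hP5base_of_HFP hd2 hη L hone hmem hs84 hcs12 ha ha2 c.sq c.lamST h66
      fun A hdat => ?_
    classical
    obtain ⟨S, hS⟩ : ∃ S : Finset (Site d), ∀ x, x ∈ S ↔ x ∈ c.sq 0 :=
      ⟨(sq_zero_finite c).toFinset, fun x => Set.Finite.mem_toFinset _⟩
    obtain ⟨B, hB'⟩ := exists_towerFinset 1 (c.lamST 1) (fun j _ => lamST_finite c 1 j)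
    obtain ⟨rG, rH, rR⟩ := REAL 1 le_rfl hk S hS B hB' _ (fun _ _ => rfl) _ rfl _ rfl
    obtain ⟨g, Δ, q, qs, Aw, cL, H', g_rightΩ, c_range, hΔ, hqs, hq, hH0, hH1, hH2, hHsupp, hHequiv, hQH, hG, hGsupp, hGreal, hRbd,
      hRreal⟩ := flatLettersRD_of_real (𝔸 := 𝔸) hd0 hη hL1 1 c.sq
        (fun j _ => sq_subset_zero c j) (c.lamST 1) w hw S hS (tower_meets_dented c hL1 hk)
        (towers_disjoint_dented c hL1 hk) B hB' _ (fun _ _ => rfl) _ rfl _ rfl rG rH rR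
    exact sockHFP₀_body_of_join_RD hd2 hL hη hk hΩc (htw 1 hk) hα₀' hα₁' hB₀ hB₀' rfl rfl hone h33 h34 hAx hdat g Δ q qs Aw cL g_rightΩ
      c_range hΔ hqs hq H' hB₀'H hB₂' hBG hBR hH0 hH1 hH2 hHsupp hHequiv hQH hG hGsupp hGreal hRbd hRreal le_rfl le_rfl le_rfl hα3'
      hα4' hsmallW hc₃ hsc hα₃' hs₁ hs₂ hs₃ hs₄ hs₅ hs₆ hs₇ hsm hprod8 rfl rfl rfl rfl hcA' ha₁' hb₁' hθ h103 h106
  · -- `P5step₁`: the step body at `U₀ = 1` with its (1.59) clause read off `H59₁` + the plain-currency bridge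
    refine hP5_of_HFP hd2 hη L c.k hone hs84 hcs12 c.sq c.lamST
      fun m hm1 hmk u₁ U₁ A hu₁ hu₁S hW h129 hLan hdat => ?_
    classical
    obtain ⟨S, hS⟩ : ∃ S : Finset (Site d), ∀ x, x ∈ S ↔ x ∈ c.sq 0 :=
      ⟨(sq_zero_finite c).toFinset, fun x => Set.Finite.mem_toFinset _⟩
    obtain ⟨B, hB'⟩ := exists_towerFinset (m + 1) (c.lamST (m + 1)) (fun j _ => lamST_finite c (m + 1) j)
    obtain ⟨rG, rH, rR⟩ := REAL (m + 1) (by omega) hmk S hS B hB' _ (fun _ _ => rfl) _ rfl _ rfl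
    obtain ⟨g, Δ, q, qs, Aw, cL, H', g_rightΩ, c_range, hΔ, hqs, hq, hH0, hH1, hH2, hHsupp, hHequiv, hQH, hG, hGsupp, hGreal, hRbd,
      hRreal⟩ := flatLettersRD_of_real (𝔸 := 𝔸) hd0 hη hL1 (m + 1) c.sq
        (fun j _ => sq_subset_zero c j) (c.lamST (m + 1)) w hw S hS (tower_meets_dented c hL1 hmk)
        (towers_disjoint_dented c hL1 hmk) B hB' _ (fun _ _ => rfl) _ rfl _ rfl rG rH rR
    have hcDAlo : (d : ℝ) * (L : ℝ) ^ 2 * (5 * (d : ℝ) * L * B₀ * ((L : ℝ) ^ 3 * α₀ + 6 * d * (L : ℝ) ^ 2 * c.M * α₀)) ≤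
        2 * (d : ℝ) * (L : ℝ) ^ 2 * (5 * (d : ℝ) * L * B₀ * ((L : ℝ) ^ 3 * α₀ + 6 * d * (L : ℝ) ^ 2 * c.M * α₀)) := by
      have h := mul_nonneg (by positivity : (0 : ℝ) ≤ (d : ℝ) * (L : ℝ) ^ 2) hcs0
      linarith only [h]
    -- Theorem 4's two-member (1.59) clause WITH THE EXTERIOR-COLLAR ALLOWANCE for this datum, from `H59D₁` (allowance `c⋆ ≤ 2Lc⋆ + 8α₄`)
    have H59Dβm : ∀ A' : Site d → Fin d → 𝔸, (∀ y τ, IsSelfAdjoint (A' y τ)) →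
        (∀ j, j ≤ m → ∀ (y : Site d) (τ : Fin d), SideTouches (c.sq j) y τ →
          U₁ y τ = cfgExp η A' y τ ∧
            ‖A' y τ‖ ≤ (5 * (d : ℝ) * L * B₀ * ((L : ℝ) ^ 3 * α₀ + 6 * d * (L : ℝ) ^ 2 * c.M * α₀)) * ((L : ℝ) ^ j * η)⁻¹) →
        (∀ (y : Site d) (τ : Fin d), (∀ j, j ≤ m → ¬ SideTouches (c.sq j) y τ) → A' y τ = 0) →
        msup L m η (-(1 : ℝ)) (fun j (b : Site d × Fin d) => SideTouches (c.sq j) b.1 b.2) (fun b => A' b.1 b.2)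
            ≤ B₀ * (bondNorm L m η (-(3 : ℝ)) c.sq (fun x μ => Jcur η (1 : Site d → Fin d → 𝔸ˣ) A' μ x)
              + wsup 1 (fun p : {p : ℕ × (Site d × Fin d) // p.1 ≤ m ∧ (p.2 ∈ c.lamBPT m p.1 ∨ (p.1 = 0 ∧ CrossB (c.sq 0) p.2))} =>
                  linCovIter L (1 : Site d → Fin d → 𝔸ˣ) (iEta η A') p.1.1 p.1.2.1 p.1.2.2))
              + Bbd * msup L m η (-(1 : ℝ)) (fun j (b : Site d × Fin d) => j = 0 ∧ SideTouches (c.sq 0) b.1 b.2 ∧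
                  ¬ BondTouches (c.sq 0) b.1 b.2) (fun b => A' b.1 b.2) ∧
          msup L m η (-(2 : ℝ)) (fun j (t : Fin d × Fin d × Site d) => SideTouches (c.sq j) t.2.2 t.2.1)
              (fun t => covDerivFwd η (1 : Site d → Fin d → 𝔸ˣ) t.1 (fun z => A' z t.2.1) t.2.2)
            ≤ B₀ * (bondNorm L m η (-(3 : ℝ)) c.sq (fun x μ => Jcur η (1 : Site d → Fin d → 𝔸ˣ) A' μ x)
              + wsup 1 (fun p : {p : ℕ × (Site d × Fin d) // p.1 ≤ m ∧ (p.2 ∈ c.lamBPT m p.1 ∨ (p.1 = 0 ∧ CrossB (c.sq 0) p.2))} =>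
                  linCovIter L (1 : Site d → Fin d → 𝔸ˣ) (iEta η A') p.1.1 p.1.2.1 p.1.2.2))
              + Bbd * msup L m η (-(1 : ℝ)) (fun j (b : Site d × Fin d) => j = 0 ∧ SideTouches (c.sq 0) b.1 b.2 ∧
                  ¬ BondTouches (c.sq 0) b.1 b.2) (fun b => A' b.1 b.2) := by
      intro A' hsa hWA hA0
      refine H59 m hm1 hmk.le u₁ U₁ A' hu₁ hu₁S hW h129 hLan hsa (fun j hj y τ hs => ⟨(hWA j hj y τ hs).1, (hWA j hj y τ hs).2.trans ?_⟩)
        hA0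
      have hw0 : 0 ≤ ((L : ℝ) ^ j * η)⁻¹ := by positivity
      refine mul_le_mul_of_nonneg_right ?_ hw0
      have h1 : 5 * (d : ℝ) * L * B₀ * ((L : ℝ) ^ 3 * α₀ + 6 * d * (L : ℝ) ^ 2 * c.M * α₀) ≤
          L * (5 * (d : ℝ) * L * B₀ * ((L : ℝ) ^ 3 * α₀ + 6 * d * (L : ℝ) ^ 2 * c.M * α₀)) := le_mul_of_one_le_left hcs0 hLr
      linarith only [h1, hcs0, hα₄0]
    exact sockHFP_body_of_join_59_γ hd2 hL hη hΩc hboxc hclassc hm1 hmk (htw (m + 1) hmk) (h8lt m hmk) (h8top m hmk) hα₀' hα₁' hB₀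
      hB₀' rfl rfl hone hmem h33 h34 hAx h135 h66 (bdryLayer_dented c hL) hBbd hBd hu₁ hu₁S hW h129 hLan hdat H59Dβm hside g13 h61γ hsmall₁ g5 g6 h16γ hsmallγ hc₃γ
      g Δ q qs Aw cL g_rightΩ c_range hΔ hqs hq
      H' hB₀'H hB₂' hBG hBR hH0 hH1 hH2 hHsupp hHequiv hQH hG hGsupp hGreal hRbd hRreal le_rfl le_rfl hcDAlo hα3' hα4' hsmallW hc₃
      hsc hα₃' hs₁ hs₂ hs₃ hs₄ hs₅ hs₆ hs₇ hsm hprod8 rfl rfl rfl rfl hcA' ha₁' hb₁' hθ h103 h106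

#print axioms prop6_dentedMember_flat_of_real_γ

open Classical in
/-- ★★ **PROPOSITION 6 (p. 99), EXISTENCE HALF, AT THE DENTED CUBE MEMBER (`CubeB8D`, [15] (148)–(150)) FROM THREE REAL INEQUALITY FAMILIES AND THE SCALAR FLAT (1.59) γ
CLAUSE WITH EXTERIOR DATA.**  `prop6_dentedMember_flat_of_real_γ` with its gauge-field hypothesis `H59Dβ₁` replaced by the SCALAR flat two-line clause at every
truncation over the split print class (`B8Ineq159FlatOfScalarBdryBeta.flat159_clause_of_scalar_bdryβ`, the class-parametric `⊗ id` transfer, at `Λb := cubeLamBP'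
… m`): NO gauge-field hypothesis remains — three REAL families on the explicit flat Dirichlet matrices + the scalar γ clauses ([4] Thm 3.3 at `U = 1`, a-priori
form, abelian, print's class; per-cube inhabitant dag-n05-w3 p585691).
[cite: Balaban1985RegularSpaces, Prop. 6 p.99, Thm 4 p.88, Prop. 5 pp.93–94, (1.59) p.86, (1.31) p.82; Balaban1985BackgroundPropagators, Thms 3.1–3.3 pp.397–399, p.394 («⊗ identity»)] -/
theorem prop6_dentedMember_flat_of_scalar_γ (hd2 : 2 ≤ d) {L : ℕ} (hL : 2 ≤ L) {B₀ B₀' B₀'H B₂' BG BR : ℝ} (hB₀ : 0 < B₀) (hB₀' : 0 < B₀')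
    (hB : 2 ≤ 5 * (d : ℝ) * L * B₀) (hB₀'H : 0 < B₀'H) (hB₂' : 0 ≤ B₂') (hBG : 0 ≤ BG) (hBR : 0 ≤ BR)
    (hfree : 3 * (2 * (d : ℝ) * (L : ℝ) ^ 2) * BG * BR ≤ B₀') {Bbd : ℝ} (hBbd : 0 ≤ Bbd) (hBd : 4 * Bbd ≤ ((d : ℝ) * L - 1) * B₀) :
    ∃ c₁ : ℝ, 0 < c₁ ∧ ∀ (η : ℝ), 0 < η → ∀ {K : ℕ} {Ω : ℕ → Set (Site d)} (c : CubeB8D d L K Ω),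
      ∀ (U₀ : Site d → Fin d → 𝔸ˣ), (∀ x κ, U₀ x κ ∈ unitaryUnits 𝔸) → ∀ (α₀ : ℝ), 0 < α₀ →
      C0 d * (α₀ * (L : ℝ) ^ 2) ≤ 1 / 3 → 2 * (α₀ * (L : ℝ) ^ 2) ≤ c2' d L →
      InAk L c.k η α₀ Ω U₀ →
      11 * (d : ℝ) ^ 2 * (L : ℝ) ^ 2 * α₀ + ((c.M : ℝ) + 4 * c.ρ) * d * (L : ℝ) ^ 2 * α₀ ≤ 1 / 6 →
      (L : ℝ) ^ 3 * α₀ + 6 * d * (L : ℝ) ^ 2 * c.M * α₀ ≤ c₁ →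
      -- the weights of `Q′ᵀaQ′` (free, nonnegative) and THE THREE REAL INEQUALITY FAMILIES at every truncation `n ≤ k` on the explicit matrices
      ∀ (w : ℕ → ℝ), (∀ j, 0 ≤ w j) →
      (∀ n, 1 ≤ n → n ≤ c.k → ∀ (S : Finset (Site d)), (∀ x, x ∈ S ↔ x ∈ c.sq 0) →
        ∀ (B : Finset (ℕ × Site d)), (∀ p, p ∈ B ↔ p.1 ≤ n ∧ p.2 ∈ c.lamST n p.1) →
        ∀ (K : Site d → Site d → ℝ), (∀ x z, K x z =
          ((η ^ 2)⁻¹ * ∑ μ : Fin d, ((2 : ℝ) * (if z = x then (1 : ℝ) else 0) - (if z = x + e μ then (1 : ℝ) else 0)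
            - (if z = x - e μ then (1 : ℝ) else 0))) +
          (∑ j ∈ Finset.range (n + 1), (if blockMap (L ^ j) x ∈ c.lamST n j ∧ blockMap (L ^ j) z = blockMap (L ^ j) x then
            w j * ((((L : ℝ) ^ d)⁻¹) ^ j) ^ 2 else 0))) →
        ∀ (T : Matrix ↥S ↥S ℝ), T = Matrix.of (fun x z : ↥S => K x.1 z.1) →
        ∀ (Q : Matrix ↥B ↥S ℝ), Q = Matrix.of (fun (p : ↥B) (z : ↥S) =>
          if blockMap (L ^ p.1.1) z.1 = p.1.2 then (((L : ℝ) ^ d)⁻¹) ^ p.1.1 else 0) →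
        -- (1.101) for `T⁻¹`, real lattice functions
        (∀ (ρ' : ↥S → ℝ) (r : ℝ), 0 ≤ r →
          (∀ j, j ≤ n → ∀ z : ↥S, z.1 ∈ c.sq j → wt L η j ^ 2 * |ρ' z| ≤ r) →
          ∀ φ : Site d → ℝ, (∀ x, x ∉ c.sq 0 → φ x = 0) → (∀ v : ↥S, φ v.1 = ∑ z : ↥S, T⁻¹ v z * ρ' z) →
          (∀ x, |φ x| ≤ BG * r) ∧
          ∀ j, j ≤ n → ∀ p ∈ {b : Site d × Fin d | SideTouches (c.sq j) b.1 b.2},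
            wt L η j * |η⁻¹ * (φ (p.1 + e p.2) - φ p.1)| ≤ BG * r) ∧
        -- (1.92) and the p. 93 `Δ`-entry for `T⁻¹(T⁻¹Qᵀ)(QT⁻¹T⁻¹Qᵀ)⁻¹`, real `X`
        (∀ (X : ↥B → ℝ) (s : ℝ), 0 ≤ s → (∀ p', |X p'| ≤ s) →
          ∀ φ : Site d → ℝ, (∀ x, x ∉ c.sq 0 → φ x = 0) →
          (∀ v : ↥S, φ v.1 = ∑ p' : ↥B, (T⁻¹ * (T⁻¹ * Qᵀ) * (Q * T⁻¹ * T⁻¹ * Qᵀ)⁻¹) v p' * X p') →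
          (∀ x, |φ x| ≤ B₀'H * s) ∧
          (∀ j, j ≤ n → ∀ p ∈ {b : Site d × Fin d | SideTouches (c.sq j) b.1 b.2},
            wt L η j * |η⁻¹ * (φ (p.1 + e p.2) - φ p.1)| ≤ B₀'H * s) ∧
          (∀ j, j ≤ n → ∀ x ∈ c.sq j,
            wt L η j ^ 2 * |∑ μ : Fin d, (η ^ 2)⁻¹ * (2 * φ x - φ (x + e μ) - φ (x - e μ))| ≤ B₂' * s)) ∧
        -- (1.98) for `1 − T⁻¹Qᵀ(QT⁻¹T⁻¹Qᵀ)⁻¹QT⁻¹`, real lattice functions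
        (∀ (ρ' : ↥S → ℝ) (r : ℝ), 0 ≤ r →
          (∀ j, j ≤ n → ∀ z : ↥S, z.1 ∈ c.sq j → wt L η j ^ 2 * |ρ' z| ≤ r) →
          ∀ j, j ≤ n → ∀ v : ↥S, v.1 ∈ c.sq j →
            wt L η j ^ 2 * |ρ' v - ∑ z : ↥S, (T⁻¹ * (Qᵀ * ((Q * T⁻¹ * T⁻¹ * Qᵀ)⁻¹ * (Q * T⁻¹)))) v z * ρ' z| ≤ BR * r)) →
      -- THE SCALAR FLAT (1.59) CLAUSE WITH THE EXTERIOR-COLLAR ALLOWANCE at every truncation `m ≤ k`: ℂ-valued bond functions in the flat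
      -- Landau gauge on the collars of `{□_j}` ([4] Thm 3.3 at `U = 1` for `G(1)` on the finite cube WITH exterior data, a-priori form, abelian)
      (∀ m, 1 ≤ m → m ≤ c.k → ∀ φ : Site d → Fin d → ℂ,
        IsLandau138 L m η (c.sq 0) (c.lamST m) (1 : Site d → Fin d → ℂˣ) φ →
        (∀ (y : Site d) (τ : Fin d), (∀ j, j ≤ m → ¬ SideTouches (c.sq j) y τ) → φ y τ = 0) →
        msup L m η (-(1 : ℝ)) (fun j (b : Site d × Fin d) => SideTouches (c.sq j) b.1 b.2) (fun b => φ b.1 b.2)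
          ≤ B₀ * (bondNorm L m η (-(3 : ℝ)) c.sq (fun x μ => Jcur η (1 : Site d → Fin d → ℂˣ) φ μ x)
            + wsup 1 (fun p : {p : ℕ × (Site d × Fin d) // p.1 ≤ m ∧ (p.2 ∈ c.lamBPT m p.1 ∨ (p.1 = 0 ∧ CrossB (c.sq 0) p.2))} =>
                linCovIter L (1 : Site d → Fin d → ℂˣ) (iEta η φ) p.1.1 p.1.2.1 p.1.2.2))
            + Bbd * msup L m η (-(1 : ℝ)) (fun j (b : Site d × Fin d) => j = 0 ∧ SideTouches (c.sq 0) b.1 b.2 ∧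
                ¬ BondTouches (c.sq 0) b.1 b.2) (fun b => φ b.1 b.2) ∧
        msup L m η (-(2 : ℝ)) (fun j (t : Fin d × Fin d × Site d) => SideTouches (c.sq j) t.2.2 t.2.1)
            (fun t => covDerivFwd η (1 : Site d → Fin d → ℂˣ) t.1 (fun z => φ z t.2.1) t.2.2)
          ≤ B₀ * (bondNorm L m η (-(3 : ℝ)) c.sq (fun x μ => Jcur η (1 : Site d → Fin d → ℂˣ) φ μ x)
            + wsup 1 (fun p : {p : ℕ × (Site d × Fin d) // p.1 ≤ m ∧ (p.2 ∈ c.lamBPT m p.1 ∨ (p.1 = 0 ∧ CrossB (c.sq 0) p.2))} =>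
                linCovIter L (1 : Site d → Fin d → ℂˣ) (iEta η φ) p.1.1 p.1.2.1 p.1.2.2))
            + Bbd * msup L m η (-(1 : ℝ)) (fun j (b : Site d × Fin d) => j = 0 ∧ SideTouches (c.sq 0) b.1 b.2 ∧
                ¬ BondTouches (c.sq 0) b.1 b.2) (fun b => φ b.1 b.2)) →
      ∃ u : Site d → 𝔸ˣ, (∀ x, u x ∈ unitaryUnits 𝔸) ∧ (∀ x, x ∉ c.sq 0 → u x = 1) ∧
        Restr129 L c.k c.lamS (1 : Site d → Fin d → 𝔸ˣ) u ∧
        IsLandau138W L c.k η (c.sq 0) c.lamS (1 : Site d → Fin d → 𝔸ˣ)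
          (gaugeAct u⁻¹ (cutFixed L (tLo c.a c.ρ) (tHi c.a c.M c.ρ) U₀ c.k (ctr c.a c.M))) ∧
        (∀ j, j ≤ c.k → ∀ b ∈ {b : Site d × Fin d | SideTouches (c.sq j) b.1 b.2},
          gaugeAct u⁻¹ (cutFixed L (tLo c.a c.ρ) (tHi c.a c.M c.ρ) U₀ c.k (ctr c.a c.M)) b.1 b.2 =
              cfgExp η (logCfg η (gaugeAct u⁻¹ (cutFixed L (tLo c.a c.ρ) (tHi c.a c.M c.ρ) U₀ c.k (ctr c.a c.M)))) b.1 b.2 ∧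
            IsSelfAdjoint (logCfg η (gaugeAct u⁻¹ (cutFixed L (tLo c.a c.ρ) (tHi c.a c.M c.ρ) U₀ c.k (ctr c.a c.M))) b.1 b.2) ∧
            ‖logCfg η (gaugeAct u⁻¹ (cutFixed L (tLo c.a c.ρ) (tHi c.a c.M c.ρ) U₀ c.k (ctr c.a c.M))) b.1 b.2‖ ≤
              (5 * (d : ℝ) * L * B₀ * ((L : ℝ) ^ 3 * α₀ + 6 * d * (L : ℝ) ^ 2 * c.M * α₀)) * ((L : ℝ) ^ j * η)⁻¹) ∧
        (∀ x, ((localGauge L (tLo c.a c.ρ) (tHi c.a c.M c.ρ) U₀ c.k (ctr c.a c.M))⁻¹ * u) x ∈ unitaryUnits 𝔸) ∧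
        AgreeOn (tlo L (tLo c.a c.ρ) c.k) (thi L (tHi c.a c.M c.ρ) c.k)
          (gaugeAct ((localGauge L (tLo c.a c.ρ) (tHi c.a c.M c.ρ) U₀ c.k (ctr c.a c.M))⁻¹ * u)⁻¹ U₀)
          (gaugeAct u⁻¹ (cutFixed L (tLo c.a c.ρ) (tHi c.a c.M c.ρ) U₀ c.k (ctr c.a c.M))) := by
  have hL1 : 1 ≤ L := le_trans (by norm_num) hL
  have hLpos : (0 : ℝ) < L := by exact_mod_cast (lt_of_lt_of_le (by norm_num) hL1)
  have hdpos : (0 : ℝ) < d := by exact_mod_cast (lt_of_lt_of_le (by norm_num) hd2 : 0 < d)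
  obtain ⟨c₁, hc₁, H⟩ := prop6_dentedMember_flat_of_real_γ (𝔸 := 𝔸) hd2 hL hB₀ hB₀' hB hB₀'H hB₂' hBG hBR hfree hBbd hBd
  -- the allowance of the step datum's exponents is `Kc·(L³α₀ + 6dL²Mα₀)`; below `1/(2Kc)` it is `≤ 1/2`, as the `⊗ id` transfer wants
  set Kc : ℝ := 2 * (L * (5 * (d : ℝ) * L * B₀)) + 8 * (8 * B₀' * (5 * (d : ℝ) * L * B₀)) with hKc_def
  have hKc : 0 < Kc := by positivity
  refine ⟨min c₁ (1 / (2 * Kc)), lt_min hc₁ (by positivity), ?_⟩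
  intro η hη K Ω c U₀ hU₀ α₀ hα hα3 hα2 hA hsmall hc w hw REAL SCALAR
  have hc1 : (L : ℝ) ^ 3 * α₀ + 6 * d * (L : ℝ) ^ 2 * c.M * α₀ ≤ c₁ := hc.trans (min_le_left _ _)
  have hcK : (L : ℝ) ^ 3 * α₀ + 6 * d * (L : ℝ) ^ 2 * c.M * α₀ ≤ 1 / (2 * Kc) := hc.trans (min_le_right _ _)
  have hs0 : 0 ≤ (L : ℝ) ^ 3 * α₀ + 6 * d * (L : ℝ) ^ 2 * c.M * α₀ := by positivity
  -- the allowance `c` of `H59D₁` and its window `0 ≤ c ≤ 1/2`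
  have hcoef : 2 * (L * (5 * (d : ℝ) * L * B₀ * (((L : ℝ) ^ 3 * α₀) + (6 * d * (L : ℝ) ^ 2 * c.M * α₀)))) +
      8 * (8 * B₀' * (5 * (d : ℝ) * L * B₀) * (((L : ℝ) ^ 3 * α₀) + (6 * d * (L : ℝ) ^ 2 * c.M * α₀))) =
      Kc * ((L : ℝ) ^ 3 * α₀ + 6 * d * (L : ℝ) ^ 2 * c.M * α₀) := by rw [hKc_def]; ring
  have hc0 : 0 ≤ 2 * (L * (5 * (d : ℝ) * L * B₀ * (((L : ℝ) ^ 3 * α₀) + (6 * d * (L : ℝ) ^ 2 * c.M * α₀)))) +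
      8 * (8 * B₀' * (5 * (d : ℝ) * L * B₀) * (((L : ℝ) ^ 3 * α₀) + (6 * d * (L : ℝ) ^ 2 * c.M * α₀))) := by
    rw [hcoef]; positivity
  have hchalf : 2 * (L * (5 * (d : ℝ) * L * B₀ * (((L : ℝ) ^ 3 * α₀) + (6 * d * (L : ℝ) ^ 2 * c.M * α₀)))) +
      8 * (8 * B₀' * (5 * (d : ℝ) * L * B₀) * (((L : ℝ) ^ 3 * α₀) + (6 * d * (L : ℝ) ^ 2 * c.M * α₀))) ≤ 1 / 2 := by
    rw [hcoef]
    calc Kc * ((L : ℝ) ^ 3 * α₀ + 6 * d * (L : ℝ) ^ 2 * c.M * α₀) ≤ Kc * (1 / (2 * Kc)) := mul_le_mul_of_nonneg_left hcK hKc.le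
      _ = 1 / 2 := by field_simp
  -- `H59D₁` from the scalar clause by the `⊗ id` transfer in the repaired currency, at every truncation
  refine H η hη c U₀ hU₀ α₀ hα hα3 hα2 hA hsmall hc1 w hw REAL ?_
  intro m hm1 hmk u W A' hu huS hW h129 hLan hsa hWA hA0
  exact flat159_clause_of_scalar_bdryβ hd2 hL1 hη m c.sq (c.lamST m) (c.lamBPT m) hB₀.le
    hBbd hc0 hchalf (SCALAR m hm1 hmk) W A' hLan hWA hA0

#print axioms prop6_dentedMember_flat_of_scalar_γ


end Literature.MathematicalPhysics.QuantumFieldTheory.Balaban1983to89.B8Prop6DentedCubeMemberFlatScalarGamma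

end
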